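import Summits.HodgeConjecture.CorCM.Model.CupRingFacts
import Summits.HodgeConjecture.CorCM.Model.CupExterior
import Summits.HodgeConjecture.CorCM.StubTree.WeightDualUnit
import HarnessLib

/-!
# COR-CM model layer (model-2): F6 `Fact_weightDual` on the Picard–CM model universe

Cell `pub-hodgecm2` (COR-CM), seat `model-2`; row Fg6 of `BINDER-OWNERS.md` = stage-1 §1c fact F6
`Universe.Fact_weightDual` (`StubTree/Qw8GeometricBlocks.lean`): Poincaré duality of the weight decomposition of
`H^•(∏_j A_{(F,Θ_j)}, ℂ)` with non-vanishing traces.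

The stage-1 package PROVES F6 (verbatim, all degrees and weights) from `ModelAxioms`, N1 `Fact_cupExterior`,
F5 `Fact_cupAssoc` and three class-M facts about the intended model (`StubTree/WeightDualUnit.lean`,
`Universe.weightDual_of_unitH0`, ported as `CorCM/StubTree/WeightDualUnit.lean`):

* `Fact_dimProd`  (`StubTree/Qw8Monomial.lean`): `dim (X × Y) = dim X + dim Y`;
* `Fact_trTopCM`  (ibid.): the top-degree trace `H^{2 dim A′}(A′, ℚ) → ℚ` of every CM product is injective;
* `Fact_unitH0`   (`StubTree/Qw8GysinDescentH0.lean`): unit classes `1_X ∈ H⁰(X, ℚ)`, natural, a left unit for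
  the cup product, spanning `H⁰` of every CM product.

Here all three are PROVED for the model of record `Model.universeOf hHD hI hU h₃` (tree objects: `Var.dim`;
`BettiUniverse.tr` = the coordinate functional of the line `H^{2n}(X(ℂ); ℚ)`, a line by `finrank_rat_top`;
`bettiOne`, `bettiCohomology.map_one`, `one_cupProduct`, and `H⁰ = ℚ · 1` of the path-connected `X(ℂ)`), whence
F6 holds on the model GIVEN its `ModelAxioms` (`universeOf_fact_weightDual`) — with N1 and F5 supplied by this cell's
`universeOf_fact_cupExterior`, `universeOf_fact_cupAssoc`.
-/

noncomputable section

open CategoryTheory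
open Literature.AlgebraicGeometry.Motives (bettiCohomology bettiOne bettiCup CMType IsSmoothProjective SchemeOver)
open Literature.AlgebraicGeometry.Motives
open Literature.AlgebraicTopology.SingularHomology
open Literature.AlgebraicGeometry.ShimuraVarieties
open Literature.NumberTheory.Automorphic
open Literature.NumberTheory.Automorphic.PicardCM
open Literature.AlgebraicGeometry.HodgeTheory

namespace Summit.HodgeConjecture.CorCM

namespace Model

/-! ### Scheme level -/

/-- The package's degree transport `castCoh` along `e` undoes the one along `e.symm`. [folklore] -/
theorem castCoh_castCoh_symm {U : Universe} (X : U.Var) {k l : ℕ} (e : k = l) (z : U.Coh X l) :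
    U.castCoh X e (U.castCoh X e.symm z) = z := by
  subst e
  rfl

/-- `H⁰(X(ℂ); ℚ) = ℚ · 1` for `X(ℂ)` path connected. [cite: HatcherAT2002, §3.1 p. 199] -/
theorem exists_eq_smul_bettiOne {X : SchemeOver ℂ} [PathConnectedSpace (ComplexPoints X)]
    (e : bettiCohomology X 0) : ∃ r : ℚ, e = r • bettiOne X :=
  ⟨_, eq_smul_one_of_pathConnectedSpace_rat e⟩

/-! ### The model of record -/

/-- **`Fact_dimProd` on the model**: `dim (X × Y) = dim X + dim Y` (by definition of `Var.dim`). [folklore] -/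
theorem universeOf_fact_dimProd (hHD : exists_isReal_hodgeModel) (hI : hodgePQ_independent_of_hodgeModel)
    (hU : BallQuotientUniformisedDatum) (h₃ : CMAbelianVarietyRealised) :
    (universeOf hHD hI hU h₃).Fact_dimProd :=
  fun _ _ ↦ rfl

/-- **`Fact_trTopCM` on the model**: the top-degree trace of every CM product is injective
(`tr_top_injective` at the smooth projective interpretation of `U.cmProd F Θ`).
[cite: VoisinHodgeI2002, §5.3.2 Thm. 5.30] -/
theorem universeOf_fact_trTopCM (hHD : exists_isReal_hodgeModel) (hI : hodgePQ_independent_of_hodgeModel)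
    (hU : BallQuotientUniformisedDatum) (h₃ : CMAbelianVarietyRealised) :
    (universeOf hHD hI hU h₃).Fact_trTopCM :=
  fun F _ Θ ↦ tr_top_injective (Var.isSmoothProjective hU h₃ ((universeOf hHD hI hU h₃).cmProd F Θ))

/-- **`Fact_unitH0` on the model**: the unit classes `1_X = bettiOne X(ℂ)` are natural (`bettiCohomology.map_one`),
left units (`one_cupProduct`, through the package's degree transport `castCoh`, `castCoh_bettiCup`), and span `H⁰` of every (path
connected) CM product. [cite: HatcherAT2002, §3.2 p. 211] -/
theorem universeOf_fact_unitH0 (hHD : exists_isReal_hodgeModel) (hI : hodgePQ_independent_of_hodgeModel)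
    (hU : BallQuotientUniformisedDatum) (h₃ : CMAbelianVarietyRealised) :
    (universeOf hHD hI hU h₃).Fact_unitH0 := by
  refine ⟨fun X ↦ bettiOne (Var.scheme hU h₃ X), fun X Y f ↦ bettiCohomology.map_one f, fun X l z ↦ ?_,
    fun F n Θ e ↦ ?_⟩
  · -- `1 ∪ z = z` in degree `0 + l` (`one_cupProduct`), through the transport `castCoh (0 + l = l)`
    apply ((universeOf hHD hI hU h₃).castCoh X (Nat.zero_add l)).injective
    rw [castCoh_castCoh_symm]
    exact (castCoh_bettiCup hHD hI hU h₃ X rfl (Nat.zero_add l) _ z).trans (one_cupProduct z)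
  · haveI := pathConnectedSpace_complexPoints
      (Var.isSmoothProjective hU h₃ ((universeOf hHD hI hU h₃).cmProd F Θ))
    exact exists_eq_smul_bettiOne e

/-- **F6 `Fact_weightDual` on the model of record, given its `ModelAxioms`** (the package's derivation
`weightDual_of_unitH0` fed with the cell's N1, F5 and the three model facts above).
[cite: Pohlmann1968, §1 Thm 1] [cite: VoisinHodgeI2002, §5.3.2 Thm. 5.30] -/
theorem universeOf_fact_weightDual (hHD : exists_isReal_hodgeModel) (hI : hodgePQ_independent_of_hodgeModel)
    (hU : BallQuotientUniformisedDatum) (h₃ : CMAbelianVarietyRealised)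
    (M : (universeOf hHD hI hU h₃).ModelAxioms) : (universeOf hHD hI hU h₃).Fact_weightDual :=
  Universe.weightDual_of_unitH0 M (universeOf_fact_cupExterior hHD hI hU h₃) (universeOf_fact_cupAssoc hHD hI hU h₃)
    (universeOf_fact_dimProd hHD hI hU h₃) (universeOf_fact_trTopCM hHD hI hU h₃) (universeOf_fact_unitH0 hHD hI hU h₃)

end Model

end Summit.HodgeConjecture.CorCM
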